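import Summits.Ventures.KdS.HorizonsB0
import HarnessLib

/-!
# Venture KdS — tiles: bilinearity of `Δ_r` in `(a², Λ)`, concavity of `Δ_r'`, Vieta

HONEST FRAMING (venture `Summits/Ventures/KdS`, cell `pub-kds`): ELEMENTARY real analysis / bookkeeping, written so
that the "window constants" hypothesis (H4) of the box theorems can be discharged PER TILE by a finite list of
rational inequalities (`norm_num`). No claim about mode stability is made here.

(A) At fixed `r`, `Δ_r`, `Δ_r'`, `Δ_r''` (with `M = 1`) are BILINEAR in `(A, L) := (a², Λ)`; a bilinear function on a
rectangle lies between the min and the max of its four corner values (`bil_ge_min4`, `bil_le_max4`).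
(B) `Δ_r''' = −8Λr ≤ 0` on `r ≥ 0`: `Δ_r'` is CONCAVE there — used only through the explicit chord identity
`deltaDeriv_chord` and the tangent identity `deltaDeriv_tangent`. (C) VIETA for three distinct zeros of the quartic:
`Λ·h₂(r₀,r₁,r₂) = 3 − Λa²`, whence the cancellation-free form of the superradiant denominator
`a² + 3/Λ − (r₀ + r₂)² = 2a² + r₁² + r₁(r₀ + r₂) − r₀r₂` (`superradiantDen_eq`). (D) `Tile`: a parameter rectangle at `M = 1`.
-/

noncomputable section

open Set

namespace Summit.Ventures.KdS

open Literature.Geometry.Lorentzian Literature.Geometry.Lorentzian.KerrDeSitter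

/-! ### Bilinear functions on a rectangle -/

/-- `bil α β γ δ A L = α + βA + γL + δAL`. -/
def bil (α β γ δ A L : ℝ) : ℝ := α + β * A + γ * L + δ * A * L

/-- The minimum of the four corner values. -/
def min4 (f : ℝ → ℝ → ℝ) (A₀ A₁ L₀ L₁ : ℝ) : ℝ :=
  min (min (f A₀ L₀) (f A₀ L₁)) (min (f A₁ L₀) (f A₁ L₁))

/-- The maximum of the four corner values. -/
def max4 (f : ℝ → ℝ → ℝ) (A₀ A₁ L₀ L₁ : ℝ) : ℝ :=
  max (max (f A₀ L₀) (f A₀ L₁)) (max (f A₁ L₀) (f A₁ L₁))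

/-- A bilinear function on a rectangle is at least the minimum of its corner values. -/
theorem bil_ge_min4 (α β γ δ : ℝ) {A₀ A₁ L₀ L₁ A L : ℝ} (hA₀ : A₀ ≤ A) (hA₁ : A ≤ A₁)
    (hL₀ : L₀ ≤ L) (hL₁ : L ≤ L₁) :
    min4 (bil α β γ δ) A₀ A₁ L₀ L₁ ≤ bil α β γ δ A L := by
  -- an affine function on a segment is at least the smaller endpoint value
  have affine_ge_min : ∀ {p q x₀ x₁ x : ℝ}, x₀ ≤ x → x ≤ x₁ →
      min (p + q * x₀) (p + q * x₁) ≤ p + q * x := by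
    intro p q x₀ x₁ x h₀ h₁
    rcases le_or_gt 0 q with hq | hq
    · exact (min_le_left _ _).trans (by nlinarith)
    · exact (min_le_right _ _).trans (by nlinarith)
  have h1 : min ((α + γ * L) + (β + δ * L) * A₀) ((α + γ * L) + (β + δ * L) * A₁) ≤
      (α + γ * L) + (β + δ * L) * A := affine_ge_min hA₀ hA₁
  have h2 : ∀ Ai, min ((α + β * Ai) + (γ + δ * Ai) * L₀) ((α + β * Ai) + (γ + δ * Ai) * L₁) ≤
      (α + β * Ai) + (γ + δ * Ai) * L := fun Ai => affine_ge_min hL₀ hL₁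
  have e : ∀ Ai Lj, bil α β γ δ Ai Lj = (α + β * Ai) + (γ + δ * Ai) * Lj := by
    intro Ai Lj; unfold bil; ring
  have e' : ∀ Ai, (α + γ * L) + (β + δ * L) * Ai = (α + β * Ai) + (γ + δ * Ai) * L := by
    intro Ai; ring
  unfold min4
  rw [e, e, e, e, e, ← e' A]
  rw [e' A₀, e' A₁] at h1
  calc min (min (α + β * A₀ + (γ + δ * A₀) * L₀) (α + β * A₀ + (γ + δ * A₀) * L₁))
        (min (α + β * A₁ + (γ + δ * A₁) * L₀) (α + β * A₁ + (γ + δ * A₁) * L₁))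
        ≤ min (α + β * A₀ + (γ + δ * A₀) * L) (α + β * A₁ + (γ + δ * A₁) * L) :=
          min_le_min (h2 A₀) (h2 A₁)
    _ ≤ _ := h1

/-- A bilinear function on a rectangle is at most the maximum of its corner values. -/
theorem bil_le_max4 (α β γ δ : ℝ) {A₀ A₁ L₀ L₁ A L : ℝ} (hA₀ : A₀ ≤ A) (hA₁ : A ≤ A₁)
    (hL₀ : L₀ ≤ L) (hL₁ : L ≤ L₁) :
    bil α β γ δ A L ≤ max4 (bil α β γ δ) A₀ A₁ L₀ L₁ := by
  have h := bil_ge_min4 (-α) (-β) (-γ) (-δ) hA₀ hA₁ hL₀ hL₁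
  have e : ∀ Ai Lj, bil (-α) (-β) (-γ) (-δ) Ai Lj = -bil α β γ δ Ai Lj := by
    intro Ai Lj; unfold bil; ring
  simp only [min4, e, min_neg_neg] at h
  unfold max4
  linarith

/-! ### `Δ_r`, `Δ_r'`, `Δ_r''` at `M = 1` as bilinear functions of `(a², Λ)` -/

/-- `Δ_r(r)` at `M = 1` as a function of `(A, L) = (a², Λ)`. -/
def dB (r A L : ℝ) : ℝ := bil (r ^ 2 - 2 * r) 1 (-(r ^ 4 / 3)) (-(r ^ 2 / 3)) A L

/-- `Δ_r'(r)` at `M = 1` as a function of `(A, L) = (a², Λ)`. -/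
def dB1 (r A L : ℝ) : ℝ := bil (2 * r - 2) 0 (-(4 * r ^ 3 / 3)) (-(2 * r / 3)) A L

/-- `Δ_r''(r)` as a function of `(A, L) = (a², Λ)`. -/
def dB2 (r A L : ℝ) : ℝ := bil 2 0 (-(4 * r ^ 2)) (-(2 / 3)) A L

/-- `Δ_r''`. -/
def deltaDeriv2 (a Λ r : ℝ) : ℝ := 2 - 4 * Λ * r ^ 2 - 2 / 3 * Λ * a ^ 2

/-- `Δ_r` (at `M = 1`) in the bilinear form `dB`. -/
theorem delta_eq_dB (a Λ r : ℝ) : delta 1 a Λ r = dB r (a ^ 2) Λ := by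
  unfold delta dB bil; ring

/-- `Δ_r'` (at `M = 1`) in the bilinear form `dB1`. -/
theorem deltaDeriv_eq_dB1 (a Λ r : ℝ) : deltaDeriv 1 a Λ r = dB1 r (a ^ 2) Λ := by
  unfold deltaDeriv dB1 bil; ring

/-- `Δ_r''` in the bilinear form `dB2`. -/
theorem deltaDeriv2_eq_dB2 (a Λ r : ℝ) : deltaDeriv2 a Λ r = dB2 r (a ^ 2) Λ := by
  unfold deltaDeriv2 dB2 bil; ring

/-! ### Concavity of `Δ_r'` on `[0, ∞)`: chord and tangent identities -/

/-- The chord identity for the cubic `Δ_r'`. -/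
theorem deltaDeriv_chord (M a Λ x y z : ℝ) :
    (z - x) * deltaDeriv M a Λ y - (z - y) * deltaDeriv M a Λ x - (y - x) * deltaDeriv M a Λ z =
      4 * Λ / 3 * (y - x) * (z - y) * (z - x) * (x + y + z) := by
  unfold deltaDeriv; ring

/-- The tangent identity for the cubic `Δ_r'`. -/
theorem deltaDeriv_tangent (M a Λ x y : ℝ) :
    deltaDeriv M a Λ y - deltaDeriv M a Λ x - deltaDeriv2 a Λ x * (y - x) =
      -(4 * Λ / 3) * (y - x) ^ 2 * (y + 2 * x) := by
  unfold deltaDeriv deltaDeriv2; ring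

section Concave

variable {M a Λ : ℝ} (hΛ : 0 ≤ Λ)
include hΛ

/-- Between two points where `Δ_r' > 0`, `Δ_r' > 0`, indeed `≥ min` of the two values. -/
theorem deltaDeriv_ge_min_between {x y z : ℝ} (hx : 0 ≤ x) (hxy : x ≤ y) (hyz : y ≤ z) :
    min (deltaDeriv M a Λ x) (deltaDeriv M a Λ z) ≤ deltaDeriv M a Λ y := by
  have hc := deltaDeriv_chord M a Λ x y z
  have hnn : 0 ≤ 4 * Λ / 3 * (y - x) * (z - y) * (z - x) * (x + y + z) := by
    have h1 : 0 ≤ y - x := by linarith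
    have h2 : 0 ≤ z - y := by linarith
    have h3 : 0 ≤ z - x := by linarith
    have h4 : 0 ≤ x + y + z := by linarith
    positivity
  rcases eq_or_lt_of_le (show x ≤ z by linarith) with hxz | hxz
  · have : y = x := by linarith
    rw [this]; exact min_le_left _ _
  · -- `(z - x) f(y) ≥ (z - y) f(x) + (y - x) f(z) ≥ (z - x) · min`
    have hm1 := min_le_left (deltaDeriv M a Λ x) (deltaDeriv M a Λ z)
    have hm2 := min_le_right (deltaDeriv M a Λ x) (deltaDeriv M a Λ z)
    nlinarith [mul_le_mul_of_nonneg_left hm1 (show 0 ≤ z - y by linarith),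
      mul_le_mul_of_nonneg_left hm2 (show 0 ≤ y - x by linarith)]

/-- Before a point `x` with `Δ_r'(x) < 0` which is followed by a point `z > x` with `Δ_r'(z) > 0`,
`Δ_r'` is `≤ Δ_r'(x)` (in particular negative). -/
theorem deltaDeriv_le_before {x y z : ℝ} (hy : 0 ≤ y) (hyx : y ≤ x) (hxz : x < z)
    (hfx : deltaDeriv M a Λ x < 0) (hfz : 0 < deltaDeriv M a Λ z) :
    deltaDeriv M a Λ y ≤ deltaDeriv M a Λ x := by
  -- chord at `x` between `y` and `z`
  have hc := deltaDeriv_chord M a Λ y x z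
  have hnn : 0 ≤ 4 * Λ / 3 * (x - y) * (z - x) * (z - y) * (y + x + z) := by
    have h1 : 0 ≤ x - y := by linarith
    have h2 : 0 ≤ z - x := by linarith
    have h3 : 0 ≤ z - y := by linarith
    have h4 : 0 ≤ y + x + z := by linarith
    positivity
  nlinarith [mul_nonneg (show 0 ≤ x - y by linarith) hfz.le,
    mul_nonpos_of_nonneg_of_nonpos (show (0 : ℝ) ≤ x - y by linarith) hfx.le]

/-- After a point `z` with `Δ_r'(z) < 0` which is preceded by a point `x < z` with `Δ_r'(x) > 0`,
`Δ_r'` is `≤ Δ_r'(z)` (in particular negative). -/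
theorem deltaDeriv_le_after {x y z : ℝ} (hx : 0 ≤ x) (hxz : x < z) (hzy : z ≤ y)
    (hfx : 0 < deltaDeriv M a Λ x) (hfz : deltaDeriv M a Λ z < 0) :
    deltaDeriv M a Λ y ≤ deltaDeriv M a Λ z := by
  -- chord at `z` between `x` and `y`
  have hc := deltaDeriv_chord M a Λ x z y
  have hnn : 0 ≤ 4 * Λ / 3 * (z - x) * (y - z) * (y - x) * (x + z + y) := by
    have h1 : 0 ≤ z - x := by linarith
    have h2 : 0 ≤ y - z := by linarith
    have h3 : 0 ≤ y - x := by linarith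
    have h4 : 0 ≤ x + z + y := by linarith
    positivity
  nlinarith [mul_nonneg (show 0 ≤ y - z by linarith) hfx.le,
    mul_nonpos_of_nonneg_of_nonpos (show (0 : ℝ) ≤ y - z by linarith) hfz.le]

/-- Tangent bound: `Δ_r'(y) ≤ Δ_r'(x) + Δ_r''(x)(y − x)` for `x, y ≥ 0`. -/
theorem deltaDeriv_le_tangent {x y : ℝ} (hx : 0 ≤ x) (hy : 0 ≤ y) :
    deltaDeriv M a Λ y ≤ deltaDeriv M a Λ x + deltaDeriv2 a Λ x * (y - x) := by
  have ht := deltaDeriv_tangent M a Λ x y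
  have : 0 ≤ 4 * Λ / 3 * (y - x) ^ 2 * (y + 2 * x) := by
    have : 0 ≤ y + 2 * x := by linarith
    positivity
  linarith

end Concave

/-! ### Vieta: the superradiant denominator in terms of the radii -/

/-- If `r₀, r₁, r₂` are three distinct zeros of `Δ_r` (`M = 1`), then
`Λ (r₀² + r₁² + r₂² + r₀r₁ + r₀r₂ + r₁r₂) = 3 − Λ a²` (second divided difference of the quartic). -/
theorem vieta_h2 {a Λ r₀ r₁ r₂ : ℝ} (h01 : r₀ ≠ r₁) (h12 : r₁ ≠ r₂) (h02 : r₀ ≠ r₂)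
    (hz₀ : delta 1 a Λ r₀ = 0) (hz₁ : delta 1 a Λ r₁ = 0) (hz₂ : delta 1 a Λ r₂ = 0) :
    Λ * (r₀ ^ 2 + r₁ ^ 2 + r₂ ^ 2 + r₀ * r₁ + r₀ * r₂ + r₁ * r₂) = 3 - Λ * a ^ 2 := by
  -- first divided differences
  have e01 : (r₁ - r₀) * (-(Λ / 3) * (r₁ ^ 3 + r₁ ^ 2 * r₀ + r₁ * r₀ ^ 2 + r₀ ^ 3) +
      (1 - Λ / 3 * a ^ 2) * (r₁ + r₀) - 2) = delta 1 a Λ r₁ - delta 1 a Λ r₀ := by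
    unfold delta; ring
  have e12 : (r₂ - r₁) * (-(Λ / 3) * (r₂ ^ 3 + r₂ ^ 2 * r₁ + r₂ * r₁ ^ 2 + r₁ ^ 3) +
      (1 - Λ / 3 * a ^ 2) * (r₂ + r₁) - 2) = delta 1 a Λ r₂ - delta 1 a Λ r₁ := by
    unfold delta; ring
  rw [hz₀, hz₁, sub_zero] at e01
  rw [hz₁, hz₂, sub_zero] at e12
  have s01 := (mul_eq_zero.mp e01).resolve_left (sub_ne_zero.mpr h01.symm)
  have s12 := (mul_eq_zero.mp e12).resolve_left (sub_ne_zero.mpr h12.symm)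
  -- second divided difference
  have e : (r₂ - r₀) * (-(Λ / 3) * (r₀ ^ 2 + r₁ ^ 2 + r₂ ^ 2 + r₀ * r₁ + r₀ * r₂ + r₁ * r₂) +
      (1 - Λ / 3 * a ^ 2)) =
      (-(Λ / 3) * (r₂ ^ 3 + r₂ ^ 2 * r₁ + r₂ * r₁ ^ 2 + r₁ ^ 3) + (1 - Λ / 3 * a ^ 2) * (r₂ + r₁) - 2) -
      (-(Λ / 3) * (r₁ ^ 3 + r₁ ^ 2 * r₀ + r₁ * r₀ ^ 2 + r₀ ^ 3) + (1 - Λ / 3 * a ^ 2) * (r₁ + r₀) - 2) := by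
    ring
  rw [s01, s12, sub_zero] at e
  have s := (mul_eq_zero.mp e).resolve_left (sub_ne_zero.mpr h02.symm)
  linarith

/-- The superradiant denominator by Vieta: `a² + 3/Λ − (r₋ + r_c)² = 2a² + r₊² + r₊(r₋ + r_c) − r₋r_c`
(`Λ ≠ 0`, the three radii distinct zeros of `Δ_r`). -/
theorem superradiantDen_eq {a Λ r₀ r₁ r₂ : ℝ} (hΛ : Λ ≠ 0) (h01 : r₀ ≠ r₁) (h12 : r₁ ≠ r₂)
    (h02 : r₀ ≠ r₂) (hz₀ : delta 1 a Λ r₀ = 0) (hz₁ : delta 1 a Λ r₁ = 0)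
    (hz₂ : delta 1 a Λ r₂ = 0) :
    a ^ 2 + 3 / Λ - (r₀ + r₂) ^ 2 = 2 * a ^ 2 + r₁ ^ 2 + r₁ * (r₀ + r₂) - r₀ * r₂ := by
  have h := vieta_h2 h01 h12 h02 hz₀ hz₁ hz₂
  have h3 : (3 : ℝ) / Λ = (r₀ ^ 2 + r₁ ^ 2 + r₂ ^ 2 + r₀ * r₁ + r₀ * r₂ + r₁ * r₂) + a ^ 2 := by
    rw [div_eq_iff hΛ]
    linear_combination -h
  rw [h3]
  ring

/-! ### Tiles and certificates -/

/-- A parameter tile at `M = 1`: `a ∈ [alo, ahi]`, `Λ ∈ [Λlo, Λhi]`. -/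
structure Tile where
  /-- lower `a` -/
  alo : ℝ
  /-- upper `a` -/
  ahi : ℝ
  /-- lower `Λ` -/
  Λlo : ℝ
  /-- upper `Λ` -/
  Λhi : ℝ

/-- The tile as a set of `(M, a, Λ)` triples (the shape the box statements consume). -/
def Tile.box (t : Tile) : Set (ℝ × ℝ × ℝ) :=
  {p | p.1 = 1 ∧ p.2.1 ∈ Icc t.alo t.ahi ∧ p.2.2 ∈ Icc t.Λlo t.Λhi}

/-- A predicate on `(A, L) = (a², Λ)` holds at the four corners of the tile. -/
def Tile.AtCorners (t : Tile) (P : ℝ → ℝ → Prop) : Prop :=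
  P (t.alo ^ 2) t.Λlo ∧ P (t.alo ^ 2) t.Λhi ∧ P (t.ahi ^ 2) t.Λlo ∧ P (t.ahi ^ 2) t.Λhi

/-- Corner minimum / maximum of a function of `(A, L)` over the tile. -/
def Tile.cmin (t : Tile) (f : ℝ → ℝ → ℝ) : ℝ := min4 f (t.alo ^ 2) (t.ahi ^ 2) t.Λlo t.Λhi

/-- Corner maximum of a function of `(A, L)` over the tile. -/
def Tile.cmax (t : Tile) (f : ℝ → ℝ → ℝ) : ℝ := max4 f (t.alo ^ 2) (t.ahi ^ 2) t.Λlo t.Λhi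

end Summit.Ventures.KdS

end
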